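import Literature.IUT.HodgeTheaters.GlobalFrobenioidsPushCarrierGaloisRich
import Literature.IUT.HodgeTheaters.Cor53iLiftsAllAtFcirc
import HarnessLib

/-!
# [IUTchI] Cor 5.3 (i) «resp. `⊚`» AS PRINTED («bijective») at EVERY EQUIVALENCE carrier `†𝒟^⊚ ⥲ †𝒟^⊛` of `G_F` (e.g. `𝟭`, the identity
# push carrier), modulo Neukirch–Uchida ONLY — the descent law `hdesc⊚` HOLDS whenever `†𝒟^⊚ → Base(†ℱ^⊛)` is an equivalence

S. Mochizuki, *Inter-universal Teichmüller theory I*, kurims manuscript (May 2020), §5 Cor 5.3 (i) p. 144 l. 2–11 («… is bijective», «resp. `†ℱ^⊚`»),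
Ex 5.1 (iii) pp. 125–126 (`†ℱ^⊚ := †ℱ^⊛|_{†𝒟^⊚}`) ([IUTchI] Cor 5.3 (i) p.144) [claim: Mochizuki2012, status: disputed] (D-0012 claim key; PROOFS about the
cell's typed carriers; nothing of the series is asserted; no side taken on [IUTchIII] Cor. 3.12).  [FrdI] §0 p. 17 [cite: MochizukiFrdI2008, §0 p.17];
[NSW] Thm. (12.2.1) = the tree's NAMED FACT `NeukirchUchida F`, held as a hypothesis (bookkeeping, not a proof) [cite: NeukirchSchmidtWingberg2008, Thm (12.2.1)].

PROOF-ONLY (cell abc-iut, seat abc-iut-L5-t4 gen 9, sequel «BIJECTIVE@IDCARRIER mod NU» to ★ p544792/★ p545785, abc-iut-L5-lead RULINGS #195;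
0 def · 0 instance · 0 notation · no Prop fact):
* §1 `GlobalFrobenioid.baseMor_isEquivalence_of_toBase0` (`toBase0` an equivalence ⇒ `baseMor` one, by `compat`) and
  **`GlobalFrobenioid.descendsAll_of_baseMor_isEquivalence`** — abc-iut-w4-d109's displayed law `hdesc⊚` of ★ `Cor53iLiftsAllAtFcirc`
  («every `Θ` of `†𝒟^⊚` descends to `Base(†ℱ^⊛)`») DISCHARGED whenever `baseMor` is an equivalence (`Θ_B := baseMor⁻¹ ⋙ Θ ⋙ baseMor`),
  so `hlift⊚` ⟸ ★ `liftsAll_fcircBase_arith_of_desc_of_neukirchUchida` BY NAME (mod NU);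
* §2 `CosetCat.nonempty_push_id_iso` (`push id ≅ 𝟭`) and `idCarrier_isEquivalence` (the identity push carrier of ★ p545785 §6);
* §3 for EVERY equivalence carrier `toBase0 : ℬ(G_F)⁰ ⥲ ℬ(G_F)⁰` and EVERY record over it: `GlobalFrobenioid.exists_galoisRich_of_toBase0_isEquivalence`
  (abc-iut-L5-t11's `hS` VERBATIM), `Cor53.fcirc_rigidOverBase_of_toBase0_isEquivalence` (`hker⊚`, NO hypothesis), and
  **`Cor53.fcirc_descendBijective_of_toBase0_isEquivalence_of_neukirchUchida (hNU) (𝓕)`** / `…_idFunctor_…` (`toBase0 := 𝟭`) — the §0 natural map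
  `Aut(†ℱ^⊚) → Aut(†𝒟^⊚)` is BIJECTIVE, LAW ∅ · FACT {`NeukirchUchida F`} ONLY (w4-d109's census LAW {hker⊚, hdesc⊚} · FACT {NU} with
  BOTH laws discharged at equivalence carriers).
At a GENERAL push carrier (`ι(H) ≠ G_F`) `hdesc⊚`/`hlift⊚` are not expected as typed (no witness filed; ★ `Cor53iLiftsAllAtFcirc` keeps
`hdesc⊚` displayed there).  OUR carriers; typed ≠ proved for print; nothing here asserts abc proved or refuted. -/

noncomputable section

namespace Literature.IUT.HodgeTheaters

open CategoryTheory Literature.AlgebraicGeometry.Frobenioids Literature.AnabelianGeometry.SemiGraphs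
open Literature.AlgebraicGeometry.Frobenioids.QuasiTemperoid Literature.NumberTheory.GaloisRepresentations

/-! ### §1 The descent law `hdesc⊚` holds when `†𝒟^⊚ → Base(†ℱ^⊛)` is an equivalence -/
namespace GlobalFrobenioid
universe u
variable {G : ProfiniteGrp.{u}} {Δ : GlobalDivisorData G} {Dcirc : Type (u + 1)} [Category.{u} Dcirc]
  {toBase0 : Dcirc ⥤ BaseCat G} (𝓕 : GlobalFrobenioid Δ Dcirc toBase0)

/-- If `†𝒟^⊚ → †𝒟^⊛` is an EQUIVALENCE, so is `baseMor : †𝒟^⊚ → Base(†ℱ^⊛)` (≅ `α₁ ⋙ toBase0 ⋙ identify⁻¹` by `compat`).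
([IUTchI] Ex 5.1 (iii) p.125) [cite: MochizukiFrdI2008, §0 p.17] [claim: Mochizuki2012, status: disputed] -/
theorem baseMor_isEquivalence_of_toBase0 [toBase0.IsEquivalence] : 𝓕.baseMor.IsEquivalence := by
  have e : (𝓕.α₁.functor ⋙ toBase0) ⋙ 𝓕.identify.inverse ≅ 𝓕.baseMor :=
    Functor.isoWhiskerRight 𝓕.compat 𝓕.identify.inverse ≪≫ Functor.associator _ _ _ ≪≫
      Functor.isoWhiskerLeft 𝓕.baseMor 𝓕.identify.unitIso.symm ≪≫ 𝓕.baseMor.rightUnitor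
  exact Functor.isEquivalence_of_iso e

/-- **`hdesc⊚` DISCHARGED when `baseMor` is an equivalence.**  abc-iut-w4-d109's displayed law binder of ★ `Cor53iLiftsAllAtFcirc`
(«every self-equivalence `Θ` of `†𝒟^⊚` DESCENDS to `Base(†ℱ^⊛)` along `baseMor`») HOLDS for every record whose `baseMor` is an
equivalence: `Θ_B := baseMor⁻¹ ⋙ Θ ⋙ baseMor`.  (At a general push carrier `ι(H) ≠ G_F` this is NOT expected: no witness filed; there
★ `liftsAll_fcircBase_arith_of_desc_of_neukirchUchida` keeps `hdesc⊚` displayed.) ([IUTchI] Cor 5.3 (i) p.144)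
[cite: MochizukiFrdI2008, §0 p.17] [claim: Mochizuki2012, status: disputed] -/
theorem descendsAll_of_baseMor_isEquivalence [𝓕.baseMor.IsEquivalence] :
    ∀ Θ : Dcirc ≌ Dcirc, ∃ ΘB : 𝓕.Base ≌ 𝓕.Base, Nonempty (Θ.functor ⋙ 𝓕.baseMor ≅ 𝓕.baseMor ⋙ ΘB.functor) := by
  intro Θ
  let E : Dcirc ≌ 𝓕.Base := 𝓕.baseMor.asEquivalence
  exact ⟨E.symm.trans (Θ.trans E), ⟨(Θ.functor ⋙ 𝓕.baseMor).leftUnitor.symm ≪≫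
    Functor.isoWhiskerRight E.unitIso (Θ.functor ⋙ E.functor) ≪≫ Functor.associator _ _ _⟩⟩

end GlobalFrobenioid

/-! ### §2 `CosetCat.push id ≅ 𝟭`; the identity push carrier is an equivalence -/
section PushId
variable {G : Type} [Group G] [TopologicalSpace G]

/-- **`φ_*` for `φ = id` is the identity up to isomorphism** (`1·id(U) ↦ 1·U`). [cite: MochizukiFrdII2008, Ex 1.3 (ii) p.11] -/
theorem CosetCat.nonempty_push_id_iso :
    Nonempty (CosetCat.push (MonoidHom.id G) IsOpenMap.id ≅ 𝟭 (CosetCat G)) := by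
  have hmem : ∀ (X : CosetCat G) (u : G), u ∈ ((CosetCat.push (MonoidHom.id G) IsOpenMap.id).obj X).sg ↔ u ∈ X.sg := by
    intro X u
    exact (CosetCat.mem_mapOpen (MonoidHom.id G) IsOpenMap.id).trans ⟨fun ⟨π, hπ, h⟩ => h ▸ hπ, fun hu => ⟨u, hu, rfl⟩⟩
  let e : ∀ X : CosetCat G, (CosetCat.push (MonoidHom.id G) IsOpenMap.id).obj X ≅ X := fun X =>
    { hom := CosetCat.homMk ((1 : G) : X.carrier) fun u hu =>
        (CosetCat.smul_one_eq_one_iff X u).mpr ((hmem X u).mp hu)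
      inv := CosetCat.homMk ((1 : G) : ((CosetCat.push (MonoidHom.id G) IsOpenMap.id).obj X).carrier) fun u hu =>
        (CosetCat.smul_one_eq_one_iff _ u).mpr ((hmem X u).mpr hu)
      hom_inv_id := CosetCat.hom_ext (by
        rw [CosetCat.pt_comp, CosetCat.pt_homMk, CosetCat.toFun_coe, CosetCat.pt_homMk, one_smul, CosetCat.pt_id])
      inv_hom_id := CosetCat.hom_ext (by
        rw [CosetCat.pt_comp, CosetCat.pt_homMk, CosetCat.toFun_coe, CosetCat.pt_homMk, one_smul, CosetCat.pt_id]) }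
  refine ⟨NatIso.ofComponents e fun {X Y} f => ?_⟩
  obtain ⟨c, hc⟩ := QuotientGroup.mk_surjective (CosetCat.pt f)
  apply CosetCat.hom_ext
  change CosetCat.pt ((CosetCat.push (MonoidHom.id G) IsOpenMap.id).map f ≫ (e Y).hom) = CosetCat.pt ((e X).hom ≫ f)
  rw [CosetCat.pt_comp, CosetCat.pt_comp, CosetCat.pt_push_map, ← hc, CosetCat.pushQuot_coe, CosetCat.toFun_coe,
    CosetCat.pt_homMk, CosetCat.pt_homMk, CosetCat.toFun_coe, one_smul, MonoidHom.id_apply,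
    MulAction.Quotient.smul_coe, smul_eq_mul, mul_one]
  exact hc

end PushId

/-- **The identity push carrier `ℬ(G)⁰ → CosetCat G → CosetCat G → ℬ(G)⁰` (`ι := id`, ★ p545785 §6) IS an equivalence** (bridges are
equivalences, `push id ≅ 𝟭`) — so §3 applies to it (`haveI := idCarrier_isEquivalence (absGalGrp F)`).
([IUTchI] Ex 5.1 (i) p.123) [cite: MochizukiFrdII2008, Ex 1.3 (ii) p.11] [claim: Mochizuki2012, status: disputed] -/
theorem idCarrier_isEquivalence (G : ProfiniteGrp.{0}) :
    (baseToCoset G ⋙ CosetCat.push (MonoidHom.id G) IsOpenMap.id ⋙ cosetToBase G).IsEquivalence := by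
  haveI := BCat.connectedToBTemp_isEquivalence G
  haveI := CosetCat.toConnected_isEquivalence (IsTempered.of_profinite (G := G))
  obtain ⟨e⟩ := CosetCat.nonempty_push_id_iso (G := G)
  haveI : (baseToCoset G ⋙ 𝟭 (CosetCat G) ⋙ cosetToBase G).IsEquivalence := inferInstance
  exact Functor.isEquivalence_of_iso
    (Functor.isoWhiskerLeft (baseToCoset G) (Functor.isoWhiskerRight e.symm (cosetToBase G)))

/-! ### §3 EVERY equivalence carrier `†𝒟^⊚ ⥲ †𝒟^⊛` (e.g. `𝟭`, the identity push carrier): `hS` inhabited, `hker⊚`, «bijective» mod NU -/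
section EquivCarrier
variable (F : Type) [Field F] [NumberField F] {toBase0 : BaseCat (absGalGrp F) ⥤ BaseCat (absGalGrp F)}

/-- **`hS` at EVERY EQUIVALENCE carrier** `toBase0 : ℬ(G_F)⁰ ⥲ ℬ(G_F)⁰` (e.g. `𝟭`): abc-iut-L5-t11's binder holds for every record, with
`S′ := (α₁ ⋙ toBase0 ⋙ baseToCoset G_F) ⋙ CosetCat.push id ⋙ cosetFixedSubext F` (`compat`, FILE A's iso, `push id ≅ 𝟭`, ★ p545785 §3).
([IUTchI] Ex 5.1 (iii) p.125) [cite: MochizukiFrdI2008, Ex. 6.3 p.113] [claim: Mochizuki2012, status: disputed] -/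
theorem GlobalFrobenioid.exists_galoisRich_of_toBase0_isEquivalence [toBase0.IsEquivalence]
    (𝓕 : GlobalFrobenioid (GlobalDivisorData.arith F) (BaseCat (absGalGrp F)) toBase0) (c : BaseCat (absGalGrp F)) :
    ∃ (S' : BaseCat (absGalGrp F) ⥤ FinSubextCat F (Fbar F)) (c₀ : BaseCat (absGalGrp F))
      (_ : ((𝓕.baseMor ⋙ 𝓕.identify.functor) ⋙ galoisSubextOfFinite F) ≅ S'),
      (∀ u : Fbar F, ∃ c : BaseCat (absGalGrp F), u ∈ (S'.obj c).L) ∧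
      (∀ c₁ c₂ : BaseCat (absGalGrp F), ∃ (c₃ : BaseCat (absGalGrp F)) (g₁ : c₃ ⟶ c₁) (g₂ : c₃ ⟶ c₂),
        (∀ y : (S'.obj c₁).L, (((S'.map g₁).toAlgHom y : (S'.obj c₃).L) : Fbar F) = y) ∧
        (∀ y : (S'.obj c₂).L, (((S'.map g₂).toAlgHom y : (S'.obj c₃).L) : Fbar F) = y)) ∧
      (∀ (σ : Fbar F ≃ₐ[(S'.obj c₀).L] Fbar F) (u : Fbar F), ∃ (c c' : BaseCat (absGalGrp F)) (g : c' ⟶ c),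
        u ∈ (S'.obj c).L ∧ ∀ y : (S'.obj c).L, (((S'.map g).toAlgHom y : (S'.obj c').L) : Fbar F) = σ y) := by
  haveI : IsGalois F (Fbar F) := isGalois_fbar F
  haveI := BCat.connectedToBTemp_isEquivalence (absGalGrp F)
  have hT : IsTempered (GalFbar F) := IsTempered.of_profinite
  let E := CosetCat.equivConnectedPart hT
  let Φ : BaseCat (absGalGrp F) ⥤ CosetCat (GalFbar F) := (𝓕.α₁.functor ⋙ toBase0) ⋙ baseToCoset (absGalGrp F)
  haveI : Φ.Full := Functor.Full.comp _ _
  haveI : Φ.EssSurj := Functor.essSurj_comp _ _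
  obtain ⟨e₂⟩ := nonempty_toConnected_galoisSubext_iso_cosetFixedSubext F hT
  obtain ⟨eid⟩ := CosetCat.nonempty_push_id_iso (G := GalFbar F)
  refine ⟨Φ ⋙ CosetCat.push (MonoidHom.id (GalFbar F)) IsOpenMap.id ⋙ cosetFixedSubext F, c, ?_,
    galoisRich_cover _ continuous_id _ Φ, galoisRich_directed _ _ Φ, galoisRich_galois _ continuous_id _ Φ c⟩
  -- `compat` · `𝟭 ≅ E⁻¹ ⋙ E` · FILE A's iso · `push id ≅ 𝟭`
  refine Functor.isoWhiskerRight 𝓕.compat.symm (galoisSubextOfFinite F) ≪≫ ?_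
  refine (Functor.isoWhiskerLeft ((𝓕.α₁.functor ⋙ toBase0) ⋙ BCat.connectedToBTemp (absGalGrp F))
    (Functor.isoWhiskerRight E.counitIso.symm (galoisSubext F)) :
      ((𝓕.α₁.functor ⋙ toBase0) ⋙ BCat.connectedToBTemp (absGalGrp F)) ⋙ 𝟭 _ ⋙ galoisSubext F ≅
        ((𝓕.α₁.functor ⋙ toBase0) ⋙ BCat.connectedToBTemp (absGalGrp F)) ⋙ (E.inverse ⋙ E.functor) ⋙ galoisSubext F) ≪≫ ?_
  refine (Functor.isoWhiskerLeft Φ e₂ : Φ ⋙ CosetCat.toConnected hT ⋙ galoisSubext F ≅ Φ ⋙ cosetFixedSubext F) ≪≫ ?_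
  exact Functor.isoWhiskerLeft Φ (Functor.isoWhiskerRight eid.symm (cosetFixedSubext F))

/-- **`hker⊚` at EVERY equivalence carrier, NO hypothesis** (★ p542877 with `hS` by the preceding theorem; `G_F` slim, ★ `isSlimGroup_absGalGrp`).
([IUTchI] Cor 5.3 (i) p.144) [cite: MochizukiFrdI2008, Prop. 1.6 p.27] [claim: Mochizuki2012, status: disputed] -/
theorem Cor53.fcirc_rigidOverBase_of_toBase0_isEquivalence [toBase0.IsEquivalence]
    (𝓕 : GlobalFrobenioid (GlobalDivisorData.arith F) (BaseCat (absGalGrp F)) toBase0) :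
    CatIsomorphism.RigidOverBase 𝓕.fcircBase := by
  haveI := BCat.connectedToBTemp_essSurj (absGalGrp F)
  obtain ⟨c, -⟩ := Functor.EssSurj.mem_essImage (F := baseToCoset (absGalGrp F)) (CosetCat.top : CosetCat (GalFbar F))
  exact Cor53.fcirc_rigidOverBase_of_galoisRich 𝓕 (isSlimGroup_absGalGrp F)
    (GlobalFrobenioid.exists_galoisRich_of_toBase0_isEquivalence F 𝓕 c)

/-- **[IUTchI] Cor 5.3 (i) «resp. `⊚`» AS PRINTED («bijective») at EVERY EQUIVALENCE carrier of `G_F`, modulo Neukirch–Uchida ONLY**: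
injectivity unconditional (preceding theorem); `hlift⊚` = abc-iut-w4-d109's ★ `liftsAll_fcircBase_arith_of_desc_of_neukirchUchida` with
`hdesc⊚` discharged by §1.  LAW ∅ · FACT {`NeukirchUchida F`}. ([IUTchI] Cor 5.3 (i) p.144) [cite: NeukirchSchmidtWingberg2008, Thm (12.2.1)] [claim: Mochizuki2012, status: disputed] -/
theorem Cor53.fcirc_descendBijective_of_toBase0_isEquivalence_of_neukirchUchida [toBase0.IsEquivalence]
    (hNU : NeukirchUchida F) (𝓕 : GlobalFrobenioid (GlobalDivisorData.arith F) (BaseCat (absGalGrp F)) toBase0) :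
    CatIsomorphism.DescendBijective 𝓕.fcircBase 𝓕.fcircBase
      (GlobalFrobenioid.hasUnder_and_underUnique_fcircBase_arith_baseCat 𝓕 𝓕 (isSlimGroup_absGalGrp F) (isSlimGroup_absGalGrp F)).1
      (GlobalFrobenioid.hasUnder_and_underUnique_fcircBase_arith_baseCat 𝓕 𝓕 (isSlimGroup_absGalGrp F) (isSlimGroup_absGalGrp F)).2 := by
  haveI := 𝓕.baseMor_isEquivalence_of_toBase0
  haveI := BCat.connectedToBTemp_essSurj (absGalGrp F)
  obtain ⟨c, -⟩ := Functor.EssSurj.mem_essImage (F := baseToCoset (absGalGrp F)) (CosetCat.top : CosetCat (GalFbar F))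
  exact Cor53.fcirc_descendBijective_of_galoisRich_of_lifts 𝓕 (isSlimGroup_absGalGrp F)
    (GlobalFrobenioid.exists_galoisRich_of_toBase0_isEquivalence F 𝓕 c)
    (𝓕.liftsAll_fcircBase_arith_of_desc_of_neukirchUchida 𝓕.descendsAll_of_baseMor_isEquivalence hNU)

/-- … at the LITERAL identity `toBase0 := 𝟭 (ℬ(G_F)⁰)`: «bijective» for EVERY record, FACT {NU} only. ([IUTchI] Cor 5.3 (i) p.144)
[cite: NeukirchSchmidtWingberg2008, Thm (12.2.1)] [claim: Mochizuki2012, status: disputed] -/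
theorem Cor53.fcirc_descendBijective_idFunctor_of_neukirchUchida (hNU : NeukirchUchida F)
    (𝓕 : GlobalFrobenioid (GlobalDivisorData.arith F) (BaseCat (absGalGrp F)) (𝟭 (BaseCat (absGalGrp F)))) :
    CatIsomorphism.DescendBijective 𝓕.fcircBase 𝓕.fcircBase
      (GlobalFrobenioid.hasUnder_and_underUnique_fcircBase_arith_baseCat 𝓕 𝓕 (isSlimGroup_absGalGrp F) (isSlimGroup_absGalGrp F)).1
      (GlobalFrobenioid.hasUnder_and_underUnique_fcircBase_arith_baseCat 𝓕 𝓕 (isSlimGroup_absGalGrp F) (isSlimGroup_absGalGrp F)).2 :=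
  Cor53.fcirc_descendBijective_of_toBase0_isEquivalence_of_neukirchUchida F hNU 𝓕

/-- … and at the identity PUSH carrier of ★ p545785 §6 (`ι := id`): «bijective» for EVERY record, FACT {NU} only.
([IUTchI] Cor 5.3 (i) p.144) [cite: NeukirchSchmidtWingberg2008, Thm (12.2.1)] [claim: Mochizuki2012, status: disputed] -/
theorem Cor53.fcirc_descendBijective_idCarrier_of_neukirchUchida (hNU : NeukirchUchida F)
    (𝓕 : GlobalFrobenioid (GlobalDivisorData.arith F) (BaseCat (absGalGrp F))
      (baseToCoset (absGalGrp F) ⋙ CosetCat.push (MonoidHom.id (GalFbar F)) IsOpenMap.id ⋙ cosetToBase (absGalGrp F))) :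
    CatIsomorphism.DescendBijective 𝓕.fcircBase 𝓕.fcircBase
      (GlobalFrobenioid.hasUnder_and_underUnique_fcircBase_arith_baseCat 𝓕 𝓕 (isSlimGroup_absGalGrp F) (isSlimGroup_absGalGrp F)).1
      (GlobalFrobenioid.hasUnder_and_underUnique_fcircBase_arith_baseCat 𝓕 𝓕 (isSlimGroup_absGalGrp F) (isSlimGroup_absGalGrp F)).2 :=
  haveI := idCarrier_isEquivalence (absGalGrp F)
  Cor53.fcirc_descendBijective_of_toBase0_isEquivalence_of_neukirchUchida F hNU 𝓕

end EquivCarrier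

end Literature.IUT.HodgeTheaters
end
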